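import Literature.AlgebraicGeometry.Frobenioids.DegreeModelFrobenioid
import Literature.AlgebraicGeometry.Frobenioids.ModelFrobenioidTypeBridge
import Literature.AlgebraicGeometry.Frobenioids.EquivalenceTransportAnchors
import Literature.AlgebraicGeometry.Frobenioids.DivisorMonoidCategoryTheoreticityDefs
import HarnessLib

/-!
# Frobenioids I, Remark 4.5.1 as the INTERFACE-typed schema `Remark451 S SI` (FACT-LIST F-1052): the
# universal closure is false — junk operations on `C^istr` of a GENUINE Frobenioid of standard type

Mochizuki, *The geometry of Frobenioids I: the general theory*, Kyushu J. Math. **62** (2008)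
293–400, §4, Remark 4.5.1, kurims text p. 86: "if `C` is of standard type, then so is `C^istr`"
[cite: MochizukiFrdI2008, Rem. 4.5.1 p.86].

PROOF-ONLY companion (cell abc-iut, block F fact-proving wave, seat abc-iut-f-025; FACT-LIST row
**F-1052** `PreFrobenioidData.Remark451`, labelled «universal-closure REFUTED / schema» by the R7 kernel
TYPE-audit of abc-iut-w5-d199 WITHOUT a kernel object for the refutation; the docstring of the instance
theorem `PreFrobenioid.remark451_holds` already records the finding "the schema is not closed for junk
`SI`" (R451-F1) in prose) of `DivisorMonoidCategoryTheoreticityDefs.lean` (seat abc-iut-L1-t3).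

The typed `Remark451 S SI := S.IsOfStandardType → SI.IsOfStandardType` takes the operations `SI` on the
full subcategory `C^istr` of isotropic objects as a FREE parameter (an arbitrary `PreFrobenioidData` on
`C^istr` over `D`), not as the restriction of `S`.  Its universal closure is therefore false as soon as
ONE category of standard type exists in the tree — and it does: abc-iut-L1-d4's model Frobenioid
`DegreeModel.C` of the data `(pt, ℕ, 0, 0)` ([FrdI] Thm. 5.2, "objects are integers, arrows `d → e` are
pairs `(k, c)` with `e = k·d + c`"), of standard type by Thm. 5.2 (iii) (`DegreeModel.isOfStandardType`)
and of isotropic type (model Frobenioids are, `ModelFrobenioid.data_isOfIsotropicType`), so that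
`C^istr = C` as a full subcategory on ALL objects.  Witness operations `SI` on `C^istr`: zero divisors,
ALL Frobenius degrees `1`, base `C^istr → C → D`.  Then the degree-one arrow `ι 0 → ι 1` is an
`SI`-isometric pre-step that is not invertible (no arrow lowers the degree), so `ι 0` is NOT
`SI`-isotropic; were `SI` of standard type, clause (a) "quasi-isotropic" would make `ι 0` an
ISO-SUBANCHOR of `C^istr ≌ C` — a purely categorical notion, transported by abc-iut-L1's
`IsIsoSubanchor.map_equivalence` — whereas `C` itself is quasi-isotropic with every object isotropic,
so it has no iso-subanchor at all:

* `DegreeModel.exists_junk_istrData_not_standard` — the witness;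
* `PreFrobenioidData.not_forall_remark451` — the universal closure (universe `0`) is FALSE (F-1052).

INSTANCE form (what consumers bind): `PreFrobenioid.remark451_holds (hF : IsFrobenioid F)` — Remark 4.5.1
for the operations `ofFunctor Φ F` of EVERY Frobenioid and THE restricted operations on `C^istr`
(`IstrStandardTypeProofs.lean`).  So the row is admissible ONLY at that instance (R5).  Refuted-closure ≠
refuted-paper; no definitions; no statement of the paper is strengthened; nothing here bears on
[IUTchIII] Cor. 3.12.
-/

noncomputable section

namespace Literature.AlgebraicGeometry.Frobenioids

open CategoryTheory

namespace DegreeModel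

/-- In the model Frobenioid of `(pt, ℕ, 0, 0)` there is no arrow `ι 1 → ι 0` (an arrow of Frobenius
degree `k ≥ 1` raises the degree to at least `k · 1 > 0`). [cite: MochizukiFrdI2008, Thm. 5.2 (i) p.100] -/
theorem isEmpty_hom_ι_one_ι_zero : IsEmpty (ι 1 ⟶ ι 0) := by
  refine ⟨fun ψ => ?_⟩
  have h := degFr_mul_dg_le ψ
  rw [dg_ι, dg_ι, mul_one] at h
  have hk : (0 : ℤ) < ((ModelFrobenioid.degFr ψ : ℕ) : ℤ) := by exact_mod_cast (ModelFrobenioid.degFr ψ).pos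
  exact absurd h (not_le.mpr hk)

/-- **A junk `PreFrobenioidData` on `C^istr` against Remark 4.5.1 as typed.**  For the model Frobenioid
`C` of `(pt, ℕ, 0, 0)` — of standard AND isotropic type, so `C^istr` is the full subcategory on all objects —
the operations on `C^istr` with zero divisors and all Frobenius degrees `1` are NOT of standard type:
`ι 0 → ι 1` is an isometric pre-step for them but not an isomorphism, while `ι 0` is no iso-subanchor
(transport along `C^istr ≌ C`, where `C` is quasi-isotropic with `ι 0` isotropic), so quasi-isotropy fails.
[cite: MochizukiFrdI2008, Rem. 4.5.1 p.86] -/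
theorem exists_junk_istrData_not_standard :
    ∃ SI : PreFrobenioidData.{0} (ModelFrobenioid.data natΦ B DivB).Istr D,
      (ModelFrobenioid.data natΦ B DivB).IsOfStandardType ∧ ¬ SI.IsOfStandardType := by
  let S₀ : PreFrobenioidData.{0} C D := ModelFrobenioid.data natΦ B DivB
  have hiso : S₀.IsOfIsotropicType := ModelFrobenioid.data_isOfIsotropicType objectwise_isGroupLike_B
  -- the junk operations on `C^istr`
  let SI : PreFrobenioidData.{0} S₀.Istr D :=
    { base := S₀.istrι ⋙ S₀.base
      Mon := fun _ => PUnit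
      pull := fun _ => MonoidHom.id _
      pull_id := fun _ _ => rfl
      pull_comp := fun _ _ _ => rfl
      div := fun _ => 1
      degFr := fun _ => 1
      div_id := fun _ => rfl
      div_comp := fun _ _ => rfl
      degFr_id := fun _ => rfl
      degFr_comp := fun _ _ => (mul_one _).symm }
  refine ⟨SI, isOfStandardType, fun hSI => ?_⟩
  -- the two objects `ι 0`, `ι 1` of `C^istr` and the degree-one arrow between them
  let A₀ : S₀.Istr := ⟨ι 0, hiso.obj _⟩
  let A₁ : S₀.Istr := ⟨ι 1, hiso.obj _⟩
  let φ : A₀ ⟶ A₁ := ObjectProperty.homMk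
    (homOf (ι 0) (ι 1) 1 (by rw [dg_ι, dg_ι, mul_zero]; exact zero_le_one))
  -- `φ` is an `SI`-isometric pre-step …
  have hφ : SI.IsIsometricPreStep φ := by
    refine ⟨⟨rfl, ?_⟩, rfl⟩
    exact isIso_D _
  -- … but not an isomorphism: its inverse would be an arrow `ι 1 → ι 0` of `C`
  have hnot : ¬ IsIso φ := by
    intro h
    exact isEmpty_hom_ι_one_ι_zero.false (inv φ).hom
  -- hence `ι 0` is not `SI`-isotropic, so by `SI`-quasi-isotropy it is an iso-subanchor of `C^istr`
  have hA₀ : IsIsoSubanchor A₀ :=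
    (hSI.quasiIsotropic.nonIsotropic_iff A₀).mp fun h => hnot (h φ hφ)
  -- transport along the equivalence `C^istr ≌ C` (every object is isotropic)
  haveI : S₀.istrι.EssSurj := ⟨fun Y => ⟨⟨Y, hiso.obj Y⟩, ⟨Iso.refl _⟩⟩⟩
  haveI : S₀.istrι.IsEquivalence := {}
  have hC : IsIsoSubanchor (ι 0) := hA₀.map_equivalence S₀.istrι.asEquivalence
  -- but `C` is quasi-isotropic and `ι 0` is isotropic: contradiction
  exact (isOfStandardType.quasiIsotropic.nonIsotropic_iff (ι 0)).mpr hC (hiso.obj _)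

end DegreeModel

/-! ### The fully quantified closure, refuted at the model Frobenioid of `(pt, ℕ, 0, 0)` -/

/-- **FACT-LIST F-1052, universal closure REFUTED** (universe `0`; witness: `S` = the operations of the
model Frobenioid of `(pt, ℕ, 0, 0)`, `SI` = the junk operations of
`DegreeModel.exists_junk_istrData_not_standard`).  The printed Remark 4.5.1 is the instance at THE
restricted operations on `C^istr`, PROVED for every Frobenioid (`PreFrobenioid.remark451_holds`).
[cite: MochizukiFrdI2008, Rem. 4.5.1 p.86] -/
theorem PreFrobenioidData.not_forall_remark451 :
    ¬ ∀ (C : Type) [Category.{0} C] (D : Type) [Category.{0} D] (S : PreFrobenioidData.{0} C D)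
        (SI : PreFrobenioidData.{0} S.Istr D),
        Literature.AlgebraicGeometry.Frobenioids.PreFrobenioidData.Remark451 S SI := by
  intro h
  obtain ⟨SI, hS, hSI⟩ := DegreeModel.exists_junk_istrData_not_standard
  exact hSI (h _ _ _ SI hS)

end Literature.AlgebraicGeometry.Frobenioids

end
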